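import Mathlib

/-!
# Stub `stub_traceHolder` for the crux `WeakCouplingHypercubicLimit` (line `Sketch`)

Finite-dimensional **trace Hölder inequality**: for a positive operator `S` (symmetric with
`⟪S x, x⟫ ≥ 0`) and an arbitrary operator `M` on a finite-dimensional real inner product space
(in particular on `ℝᵈ = EuclideanSpace ℝ (Fin d)`),

  `|tr (S M)| ≤ tr (S) · ‖M‖`,

where `‖M‖` is the operator norm.  Proof: diagonalise `S` in an orthonormal eigenbasis `b` with
eigenvalues `λᵢ ≥ 0`; then `tr (S M) = Σ ⟪bᵢ, S (M bᵢ)⟫ = Σ ⟪S bᵢ, M bᵢ⟫ = Σ λᵢ ⟪bᵢ, M bᵢ⟫`,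
`tr S = Σ λᵢ`, and `|⟪bᵢ, M bᵢ⟫| ≤ ‖bᵢ‖ ‖M bᵢ‖ ≤ ‖M‖` (Cauchy–Schwarz and the operator-norm bound).
This is the finite-dimensional case of the bound `|tr (A B)| ≤ ‖A‖₁ ‖B‖` (Simon, *Trace ideals and
their applications*, Thm 3.1-type bound); here it is `[folklore]` linear algebra over Mathlib's
`LinearMap.trace_eq_sum_inner` and `LinearMap.IsSymmetric.eigenvectorBasis`.
-/

noncomputable section

open scoped BigOperators InnerProductSpace

namespace Summit.QuantumFields.YangMills.Theorems.WeakCouplingHypercubicLimit.TraceNormColdPressure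

/-- **Trace Hölder inequality on a finite-dimensional real inner product space.**  For a positive
continuous linear map `S` and any continuous linear map `M` on a finite-dimensional real inner
product space `E`, `|tr (S M)| ≤ tr (S) · ‖M‖`: in an orthonormal eigenbasis `b` of `S` with
eigenvalues `λᵢ ≥ 0`, `tr (S M) = Σ λᵢ ⟪bᵢ, M bᵢ⟫`, `tr S = Σ λᵢ`, `|⟪bᵢ, M bᵢ⟫| ≤ ‖M‖`. [folklore] -/
private theorem abs_trace_mul_le_trace_mul_opNorm {E : Type*} [NormedAddCommGroup E]
    [InnerProductSpace ℝ E] [FiniteDimensional ℝ E] (S M : E →L[ℝ] E) (hS : S.IsPositive) :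
    |LinearMap.trace ℝ E (↑(S * M) : E →ₗ[ℝ] E)| ≤ LinearMap.trace ℝ E (↑S : E →ₗ[ℝ] E) * ‖M‖ := by
  have hsymm : (↑S : E →ₗ[ℝ] E).IsSymmetric := hS.isSymmetric
  have hn : Module.finrank ℝ E = Module.finrank ℝ E := rfl
  -- orthonormal eigenbasis of `S` and its (nonnegative) eigenvalues
  set b : OrthonormalBasis (Fin (Module.finrank ℝ E)) ℝ E := hsymm.eigenvectorBasis hn with hb
  set ev : Fin (Module.finrank ℝ E) → ℝ := hsymm.eigenvalues hn with hev
  have hev_nonneg : ∀ i, 0 ≤ ev i := fun i => hS.toLinearMap.nonneg_eigenvalues hn i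
  have hSb : ∀ i, S (b i) = ev i • b i := fun i => by
    have h := hsymm.apply_eigenvectorBasis hn i
    rw [ContinuousLinearMap.coe_coe] at h
    exact h
  -- diagonal entries of `S M` and of `S` in the eigenbasis
  have h1 : ∀ i, ⟪b i, (↑(S * M) : E →ₗ[ℝ] E) (b i)⟫_ℝ = ev i * ⟪b i, M (b i)⟫_ℝ := fun i => by
    rw [ContinuousLinearMap.coe_coe, mul_apply_eq_comp,
      ← hS.inner_left_eq_inner_right, hSb i, real_inner_smul_left]
  have h2 : ∀ i, ⟪b i, (↑S : E →ₗ[ℝ] E) (b i)⟫_ℝ = ev i := fun i => by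
    rw [ContinuousLinearMap.coe_coe, hSb i, real_inner_smul_right,
      real_inner_self_eq_norm_sq, b.orthonormal.1 i]
    ring
  -- each diagonal entry of `M` is bounded by the operator norm
  have h3 : ∀ i, |⟪b i, M (b i)⟫_ℝ| ≤ ‖M‖ := fun i => by
    calc |⟪b i, M (b i)⟫_ℝ| ≤ ‖b i‖ * ‖M (b i)‖ := abs_real_inner_le_norm _ _
      _ ≤ ‖b i‖ * (‖M‖ * ‖b i‖) := by
          gcongr
          exact M.le_opNorm (b i)
      _ = ‖M‖ := by rw [b.orthonormal.1 i]; ring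
  rw [LinearMap.trace_eq_sum_inner _ b, LinearMap.trace_eq_sum_inner _ b]
  simp only [h1, h2]
  rw [Finset.sum_mul]
  refine (Finset.abs_sum_le_sum_abs _ _).trans (Finset.sum_le_sum fun i _ => ?_)
  rw [abs_mul, abs_of_nonneg (hev_nonneg i)]
  exact mul_le_mul_of_nonneg_left (h3 i) (hev_nonneg i)

/-- `stub_traceHolder` (S1) — **finite-dimensional trace Hölder inequality**: for a positive operator
`S` and any operator `M` on `ℝᵈ`, `|tr(S M)| ≤ tr(S)·‖M‖` (diagonalise `S = Σ λᵢ |eᵢ⟩⟨eᵢ|`, `λᵢ ≥ 0`: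
`tr(S M) = Σ λᵢ ⟨eᵢ, M eᵢ⟩`, `tr S = Σ λᵢ`, `|⟨eᵢ, M eᵢ⟩| ≤ ‖M‖`).  Finite-dimensional case of
Simon, *Trace ideals and their applications*, Thm 3.1-type bound `|tr(A B)| ≤ ‖A‖₁‖B‖`. [folklore] -/
theorem stub_traceHolder :
    ∀ (d : ℕ) (S M : EuclideanSpace ℝ (Fin d) →L[ℝ] EuclideanSpace ℝ (Fin d)), S.IsPositive →
      |LinearMap.trace ℝ _ (↑(S * M) : EuclideanSpace ℝ (Fin d) →ₗ[ℝ] EuclideanSpace ℝ (Fin d))| ≤ LinearMap.trace ℝ _ (↑(S) : EuclideanSpace ℝ (Fin d) →ₗ[ℝ] EuclideanSpace ℝ (Fin d)) * ‖M‖ :=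
  fun _ S M hS => abs_trace_mul_le_trace_mul_opNorm S M hS

end Summit.QuantumFields.YangMills.Theorems.WeakCouplingHypercubicLimit.TraceNormColdPressure

end
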